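/-
Origin: expansion seat `planner-pub-hodgecm-mc-axioms-1-g14-0`, handover #W137 2026-08-20T15:53:55Z md5 2ab5b007adda (PKG d4da71004e81 → 2ab5b007adda; 106 l.; MECHANICAL (iib-R) rewrite v3.1 of the PKG file as it stands (61 token edits; rules R1x1+RX[h₂]x60)) (`HOME/mc/pub-hodgecm-mc-axioms-1-g14/revendor/kit-r55/stage55/HodgeCM/Model/E2InstanceR3.lean`, md5 2ab5b007adda, 106 lines);
landed by the gen-22 packager (p-g22) in gate run 55 REPLACES the earlier landed copy of `HodgeCM/Model/E2InstanceR3.lean` (seat copy carried the packager Origin header of an earlier run (stripped)).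
-/
/-
Unit pub-hodgecm-mc-glue-1-g2 (node E = E ASSEMBLER, vacancy (iii)). NEW additive leaf `HodgeCM/Model/E2InstanceR3.lean`
(imports `E2InstanceR2` + T-cov `CoverInstance`). No proof holes; every undischarged input is an explicit binder.
Expected `#print axioms`: {propext, Classical.choice, Quot.sound}.
-/
import Summits.HodgeConjecture.HodgeCM.Model.E2InstanceR2
import Summits.HodgeConjecture.HodgeCM.Model.CoverInstance

/-!
# E2 instance, revision 3: the level covering `cover` CONSTRUCTED

`Model.perL_picardCM_r3` = `Model.perL_picardCM_r2` with the DATA binder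
`cover : ∀ Γ Γ', Γ' ≤ Γ → U.Mor (U.pms L ι₁ V Γ') (U.pms L ι₁ V Γ)` REPLACED BY THE TERM
`Model.coverOf hHD hI h₁ h₃ hA` of `HodgeCM/Model/CoverInstance.lean` (vacancy (ii-cov): the level covering of
the ball quotients is holomorphic in the analytic charts of the chosen models — KERNEL, `LevelCovering.exists_hom_map_unif_eq`
of `HodgeCM/Model/LevelCovering.lean` — hence a morphism of the models by the record
`hA : Arapura2012_Cor_15_4_6` = MODEL-N row N-G0-cov, the one new binder).  Every consumer of `cover`
(C4 `BallFacts`, C5′/C6′ `Gen12FunBridge` / `Real34FunBridge`, `occ`) now sees this term; its defining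
junction is `Model.map_coverOf_unif`.

Remaining binders (unchanged types, `cover` gone, `hA` new): `hHR`, `h`, `emb`, `wm`, `Theta`, `d12`, `d34`,
`innerEmb`, `h31`, `hLiu`, `ball`, `ballFacts`, `lines`, `gen12`, `real34`, `occ`.
-/

noncomputable section

open scoped TensorProduct InnerProductSpace

namespace HodgeCM

namespace Model

open HodgeCM.Universe (AdelicThetaCore AdelicThetaCore₀ SideData ThetaModel ModelAxiomsPerL)
open Literature.AlgebraicGeometry.HodgeTheory
open Literature.NumberTheory.Automorphic.PicardCM
open Literature.NumberTheory.Transcendental (Arapura2012_Cor_15_4_6)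
open HodgeCM.CMTypeOps (inflate)
open HodgeCM.Model.SupplyInstance (LineSupplyData)

variable (hHD : exists_isReal_hodgeModel) (hI : hodgePQ_independent_of_hodgeModel)
  (h₁ : BallQuotientUniformised)  (h₃ : CMAbelianVarietyRealised)

/-- **E2 instance, revision 3** (see the module docstring): `perL_picardCM_r2` at
`cover := Model.coverOf hHD hI h₁ h₃ hA`. -/
theorem perL_picardCM_r3 (hHR : BettiUniverse.HodgeRiemann20) (h : Bool)
    (emb : ∀ {L : CMField} {ι₁ : L →+* ℂ} {V : HermSpace3 L ι₁} (Γ : Level V),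
      (picardCMUniverse hHD hI h₁ h₃).CohC ((picardCMUniverse hHD hI h₁ h₃).pms L ι₁ V Γ) 2 →ₗ[ℂ]
        (V.latticeModel printFact_unitaryCompact_holds).toQuotientModel.H)
    (hA : Arapura2012_Cor_15_4_6)
    (wm : ∀ {L : CMField} {ι₁ : L →+* ℂ} (V : HermSpace3 L ι₁) (c : SeesawCtx L),
      WeilThetaModel (V.latticeModel printFact_unitaryCompact_holds).toQuotientModel.G
        (V.latticeModel printFact_unitaryCompact_holds).toQuotientModel.Γ
        (c.D.latticeModelW printFact_unitaryCompact_holds).toQuotientModel.G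
        (c.D.latticeModelW printFact_unitaryCompact_holds).toQuotientModel.Γ)
    (Theta : ∀ {L : CMField} {ι₁ : L →+* ℂ} (V : HermSpace3 L ι₁), SeesawCtx L → Fin 4 → ∀ Γ : Level V,
      Set ((picardCMUniverse hHD hI h₁ h₃).CohC ((picardCMUniverse hHD hI h₁ h₃).pms L ι₁ V Γ) 1))
    (d12 d34 : ∀ {L : CMField}, SeesawCtx L → SideData L)
    (innerEmb : ∀ {L : CMField} {ι₁ : L →+* ℂ} (V : HermSpace3 L ι₁) (c : SeesawCtx L),
      (thetaModelOf hHD hI h₁ h₃ h emb (coverOf hHD hI h₁ h₃ hA) wm Theta d12 d34).GoodCtx ι₁ c → Module.finrank ℚ c.K = 6 →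
      (thetaModelOf hHD hI h₁ h₃ h emb (coverOf hHD hI h₁ h₃ hA) wm Theta d12 d34).InnerEmbAt V)
    (h31 : (picardCMUniverse hHD hI h₁ h₃).Fact_cmInflation)
    (hLiu : ∀ {L : CMField} {ι₁ : L →+* ℂ} (V : HermSpace3 L ι₁) (c : SeesawCtx L),
      (thetaModelOf hHD hI h₁ h₃ h emb (coverOf hHD hI h₁ h₃ hA) wm Theta d12 d34).GoodCtx ι₁ c → Module.finrank ℚ c.K = 6 →
      ∀ (i : Fin 4) (Γ : Level V), ∃ (M : CMField) (k : c.K →+* M) (σ' : M →+* ℂ), σ'.comp k = c.σ ∧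
        (thetaModelOf hHD hI h₁ h₃ h emb (coverOf hHD hI h₁ h₃ hA) wm Theta d12 d34).Theta V c i Γ ⊆
          (picardCMUniverse hHD hI h₁ h₃).Uiso Γ M (inflate k (c.Ψ i)) σ')
    (ball : ∀ {L : CMField} {ι₁ : L →+* ℂ} (V : HermSpace3 L ι₁) (c : SeesawCtx L),
      (picardCMUniverse hHD hI h₁ h₃).BallData V c)
    (ballFacts : ∀ {L : CMField} {ι₁ : L →+* ℂ} (V : HermSpace3 L ι₁) (c : SeesawCtx L),
      (thetaModelOf hHD hI h₁ h₃ h emb (coverOf hHD hI h₁ h₃ hA) wm Theta d12 d34).GoodCtx ι₁ c → Module.finrank ℚ c.K = 6 →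
      (thetaModelOf hHD hI h₁ h₃ h emb (coverOf hHD hI h₁ h₃ hA) wm Theta d12 d34).BallFacts V c (ball V c))
    (lines : ∀ {L : CMField} {ι₁ : L →+* ℂ} (V : HermSpace3 L ι₁) (c : SeesawCtx L),
      (thetaModelOf hHD hI h₁ h₃ h emb (coverOf hHD hI h₁ h₃ hA) wm Theta d12 d34).GoodCtx ι₁ c → Module.finrank ℚ c.K = 6 →
      Nonempty (LineSupplyData (thetaModelOf hHD hI h₁ h₃ h emb (coverOf hHD hI h₁ h₃ hA) wm Theta d12 d34) V c 0) ∧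
        Nonempty (LineSupplyData (thetaModelOf hHD hI h₁ h₃ h emb (coverOf hHD hI h₁ h₃ hA) wm Theta d12 d34) V c 1))
    (gen12 : ∀ {L : CMField} {ι₁ : L →+* ℂ} (V : HermSpace3 L ι₁) (c : SeesawCtx L),
      (thetaModelOf hHD hI h₁ h₃ h emb (coverOf hHD hI h₁ h₃ hA) wm Theta d12 d34).GoodCtx ι₁ c → Module.finrank ℚ c.K = 6 →
      Nonempty ((thetaModelOf hHD hI h₁ h₃ h emb (coverOf hHD hI h₁ h₃ hA) wm Theta d12 d34).Gen12FunBridge V c))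
    (real34 : ∀ {L : CMField} {ι₁ : L →+* ℂ} (V : HermSpace3 L ι₁) (c : SeesawCtx L),
      (thetaModelOf hHD hI h₁ h₃ h emb (coverOf hHD hI h₁ h₃ hA) wm Theta d12 d34).GoodCtx ι₁ c → Module.finrank ℚ c.K = 6 →
      Nonempty ((thetaModelOf hHD hI h₁ h₃ h emb (coverOf hHD hI h₁ h₃ hA) wm Theta d12 d34).Real34FunBridge V c))
    (occ : ∀ {L : CMField} {ι₁ : L →+* ℂ} (V : HermSpace3 L ι₁) (c : SeesawCtx L),
      (thetaModelOf hHD hI h₁ h₃ h emb (coverOf hHD hI h₁ h₃ hA) wm Theta d12 d34).GoodCtx ι₁ c → Module.finrank ℚ c.K = 6 →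
      (∀ (Φ : (thetaModelOf hHD hI h₁ h₃ h emb (coverOf hHD hI h₁ h₃ hA) wm Theta d12 d34).SK V c)
          (i : (thetaModelOf hHD hI h₁ h₃ h emb (coverOf hHD hI h₁ h₃ hA) wm Theta d12 d34).SigIdx V c),
          (∃ v ∈ ((thetaModelOf hHD hI h₁ h₃ h emb (coverOf hHD hI h₁ h₃ hA) wm Theta d12 d34).core V c).hatσ i,
              ((thetaModelOf hHD hI h₁ h₃ h emb (coverOf hHD hI h₁ h₃ hA) wm Theta d12 d34).core V c).TΦ Φ v ≠ 0) →
          ((thetaModelOf hHD hI h₁ h₃ h emb (coverOf hHD hI h₁ h₃ hA) wm Theta d12 d34).t12 V c).wOccurs i) ∧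
        (∀ (Φ : (thetaModelOf hHD hI h₁ h₃ h emb (coverOf hHD hI h₁ h₃ hA) wm Theta d12 d34).SK V c)
          (i : (thetaModelOf hHD hI h₁ h₃ h emb (coverOf hHD hI h₁ h₃ hA) wm Theta d12 d34).SigIdx V c),
          (∃ v ∈ ((thetaModelOf hHD hI h₁ h₃ h emb (coverOf hHD hI h₁ h₃ hA) wm Theta d12 d34).core V c).hatσ i,
              ((thetaModelOf hHD hI h₁ h₃ h emb (coverOf hHD hI h₁ h₃ hA) wm Theta d12 d34).core V c).TΦ Φ v ≠ 0) →
          ((thetaModelOf hHD hI h₁ h₃ h emb (coverOf hHD hI h₁ h₃ hA) wm Theta d12 d34).t34 V c).wOccurs i)) :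
    (picardCMUniverse hHD hI h₁ h₃).PerL :=
  perL_picardCM_r2 hHD hI h₁ h₃ hHR h emb (coverOf hHD hI h₁ h₃ hA) wm Theta d12 d34 innerEmb h31 hLiu
    ball ballFacts lines gen12 real34 occ

end Model

end HodgeCM

end
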